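import Mathlib
import Summits.Ventures.HodgeRepro.Tier4.Target
import Summits.Ventures.HodgeRepro.Tier4.Common.TargetBall
import Summits.Ventures.HodgeRepro.Tier4.Common.TargetCalculus
import Summits.Ventures.HodgeRepro.Tier4.Common.TargetJacobian
import Summits.Ventures.HodgeRepro.Tier4.Common.AutForms
import Summits.Ventures.HodgeRepro.Tier4.LitCompactness
import Summits.Ventures.HodgeRepro.Tier4.Line3.KMDatumS
import Summits.Ventures.HodgeRepro.Tier4.Line3.Defs
import Summits.Ventures.HodgeRepro.Tier4.Line3.HeckeEquivarianceLemmas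
import Summits.Ventures.HodgeRepro.Tier4.Line3.LocaliserS
import Summits.Ventures.HodgeRepro.Tier4.Line3.BallChangeOfVariables
import Summits.Ventures.HodgeRepro.Tier4.Line3.DomainTransfer
import Summits.Ventures.HodgeRepro.Tier4.Line3.KernelIntegrable
import Summits.Ventures.HodgeRepro.Tier4.Line3.MajorantLemmas
import Summits.Ventures.HodgeRepro.Tier4.Line3.IntegrableMajorant
import Summits.Ventures.HodgeRepro.Tier4.Line3.ExpansionPointwise
import Summits.Ventures.HodgeRepro.Tier4.Line3.Expansion
import Summits.Ventures.HodgeRepro.Tier4.Line3.DecaySum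
import Summits.Ventures.HodgeRepro.Tier4.Line3.TermDominatedAssembly
import Summits.Ventures.HodgeRepro.Tier4.Line3.InvariantDensityTransfer
import Summits.Ventures.HodgeRepro.Tier4.Line3.OffMainInvariance
import Summits.Ventures.HodgeRepro.Tier4.Line3.GoodDomainCovering
import Summits.Ventures.HodgeRepro.Tier4.Line3.BoundaryDistance

/-!
# Tier4/Line3/OffMainMassAssembly — the residual `OffMainMass` of L3.5 from three displayed rungs

Blind re-derivation cell `pub-hodge-repro`, Tier 4 «PROVE THE STEP» (README §9–§10), LINE L3, seat t4-L2-p1 (on L3.5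
with t4-L2-p3 / t4-L3-p2, lead S12654).  The rungs of the residual, typed (t4-L3-p2's ask S12898):

* **(A) `PointwiseOffMainBound`** — the off-main density at depth `N` is bounded on the WHOLE ball by
  `K e^{−κ q^{N/d}} / (1 − nsq z)^m`, constants independent of `N` (the class bound with the definite Gaussians kept,
  summed over the support lattices: t4-L2-p3's `SupportMassBound` chain + the lattice Gaussian sums);
* **(B) `BoundedCosetReps`** — representatives of the level in `Γ` with their inverses of ARCHIMEDEAN SIZE at most
  `Cr · q₀^{kN}` (the count `≤ ((q₀^N)^d)^9` is t4-L2-p3's `exists_cosetReps_principalCongruence`; the size is the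
  reduction-theoretic clause still open in the tree);
* **(C)** the BHC relatively compact fundamental domain of `Γ` and the fundamental-domain property of the chosen
  domains of the levels (the LitCompactness row, as in L3.c).

**`offMainMass_of_bounds`**: (A) + (B) + (C) ⟹ `Nonempty (OffMainMass …)`, hence (`TermDominatedAssembly`) L3.5.
The chain: `∫⁻_{D_N} ρ_N ≤ Σ_{r ∈ R_N} ∫⁻_{r⁻¹(F)} ρ_N` (`GoodDomainCovering`, with the invariance of `ρ_N` from
`OffMainInvariance`); on `r⁻¹(F)` the distance to the boundary is `≥ (1 − r₀)/(9 B_N²)` (`BoundaryDistance`, the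
entries of `M(r⁻¹) = C⁻¹ τ₀(r⁻¹) C` being `≤ B_N := 9 b₁ b₂ Cr q₀^{kN}`), so by (A) the density is
`≤ K e^{−κ…} (9 B_N²/(1 − r₀))^m` there; each translate has Lebesgue measure `≤ vol(closedBall 0 1)`; the count of the
translates is `≤ q₀^{9dN}`.  Hence `∫⁻_{D_N} ρ_N ≤ M₀ q₁^N e^{−κ q^{N/d}}` with `q₁ = q₀^{9d + 2km}`.
`offMainMass_of_bounds_of_lit` takes (C) from the printed row `Lit.BorelHarishChandra1962_Thm11_8_fundamentalDomain_hdef`.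
No printed input is consumed silently: (C) is displayed as the row, (A) and (B) as hypotheses.
Nothing here asserts anything about the truth of (P); HC_CM is NOT proved by anyone in this repository.
-/

set_option autoImplicit false

noncomputable section

namespace Summit.Ventures.HodgeRepro.Tier4.Line3

open Summit.Ventures.HodgeRepro.Tier4
open Matrix MeasureTheory
open scoped ComplexConjugate ENNReal

/-! ## 1. Entry bounds of matrix products -/

/-- An entry of a product is at most `3 a b` when the entries of the factors are at most `a`, `b`. -/
theorem norm_mul_apply_le {P Q : Matrix (Fin 3) (Fin 3) ℂ} {a b : ℝ} (ha : 0 ≤ a)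
    (hP : ∀ i j, ‖P i j‖ ≤ a) (hQ : ∀ i j, ‖Q i j‖ ≤ b) (i j : Fin 3) : ‖(P * Q) i j‖ ≤ 3 * (a * b) := by
  calc ‖(P * Q) i j‖ = ‖∑ k, P i k * Q k j‖ := by rw [Matrix.mul_apply]
    _ ≤ ∑ k, ‖P i k * Q k j‖ := norm_sum_le _ _
    _ ≤ ∑ k : Fin 3, a * b := by
        refine Finset.sum_le_sum fun k _ => ?_
        rw [norm_mul]
        exact mul_le_mul (hP i k) (hQ k j) (norm_nonneg _) ha
    _ = 3 * (a * b) := by simp [Finset.sum_const]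

/-- Every matrix has a bound on its entries (the sum of their norms). -/
theorem exists_entry_bound (P : Matrix (Fin 3) (Fin 3) ℂ) : ∃ b : ℝ, 0 ≤ b ∧ ∀ i j, ‖P i j‖ ≤ b := by
  refine ⟨∑ i, ∑ j, ‖P i j‖, Finset.sum_nonneg fun i _ => Finset.sum_nonneg fun j _ => norm_nonneg _, fun i j => ?_⟩
  calc ‖P i j‖ ≤ ∑ j, ‖P i j‖ := Finset.single_le_sum (fun j _ => norm_nonneg _) (Finset.mem_univ j)
    _ ≤ ∑ i, ∑ j, ‖P i j‖ :=
        Finset.single_le_sum (fun i _ => Finset.sum_nonneg fun j _ => norm_nonneg _) (Finset.mem_univ i)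

namespace T4Data

variable (X : T4Data)

/-- The entries of `M(g) = C⁻¹ τ₀(g) C` are bounded by `9 b₁ b₂ a` when those of `τ₀(g)` are bounded by `a`. -/
theorem norm_toBallMat_apply_le {b₁ b₂ : ℝ} (hb₁ : 0 ≤ b₁) (hC₁ : ∀ i j, ‖X.C⁻¹ i j‖ ≤ b₁)
    (hC₂ : ∀ i j, ‖X.C i j‖ ≤ b₂) {g : Matrix (Fin 3) (Fin 3) X.E} {a : ℝ} (ha : 0 ≤ a)
    (hg : ∀ i j, ‖X.τ₀ (g i j)‖ ≤ a) (i j : Fin 3) :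
    ‖toBallMat X.τ₀ X.C g i j‖ ≤ 9 * (b₁ * b₂ * a) := by
  unfold toBallMat
  have h1 : ∀ i j, ‖(X.C⁻¹ * g.map X.τ₀) i j‖ ≤ 3 * (b₁ * a) :=
    norm_mul_apply_le hb₁ hC₁ (fun i j => by simpa [Matrix.map_apply] using hg i j)
  have h2 := norm_mul_apply_le (by positivity) h1 hC₂ i j
  calc ‖(X.C⁻¹ * g.map X.τ₀ * X.C) i j‖ ≤ 3 * (3 * (b₁ * a) * b₂) := h2
    _ = 9 * (b₁ * b₂ * a) := by ring

/-! ## 2. The rungs, typed -/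

/-- **(A) THE POINTWISE BOUND of the off-main density on the ball**, uniform in the depth. -/
def PointwiseOffMainBound (D : X.ThetaData) (p : IsDedekindDomain.HeightOneSpectrum (NumberField.RingOfIntegers X.E))
    (L₀ : Submodule (NumberField.RingOfIntegers X.E) (Fin 3 → X.E)) (xm : X.Tuple) (ℓ : X.LocS D p L₀ xm) : Prop :=
  ∃ (K κ : ℝ) (m : ℕ), 0 < κ ∧ 0 ≤ K ∧ ∀ N (z : Fin 2 → ℂ), z ∈ ball →
    X.offMainDensity D (ℓ.loc N) xm z ≤ ENNReal.ofReal (K * X.offMainDecay p κ N / (1 - nsq z) ^ m)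

/-- **(B) COSET REPRESENTATIVES OF THE LEVEL IN `Γ` OF BOUNDED ARCHIMEDEAN SIZE**: for every depth a finite set
`R ⊆ Γ` with `γ = r δ` (`δ` in the level), at most `((q₀^N)^d)^9` elements, whose inverses `r′ ∈ Γ` have entries of
size `≤ Cr · q₀^{kN}` at `τ₀`. -/
def BoundedCosetReps (D : X.ThetaData) (p : IsDedekindDomain.HeightOneSpectrum (NumberField.RingOfIntegers X.E))
    (L₀ : Submodule (NumberField.RingOfIntegers X.E) (Fin 3 → X.E)) (xm : X.Tuple) (ℓ : X.LocS D p L₀ xm)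
    (q₀ : ℕ) : Prop :=
  ∃ (Cr : ℝ) (k : ℕ), 0 ≤ Cr ∧ ∀ N, ∃ R : Set (Matrix (Fin 3) (Fin 3) X.E), R.Finite ∧ R ⊆ X.Γ ∧
    Nat.card R ≤ ((q₀ ^ N) ^ Module.finrank ℚ X.E) ^ 9 ∧
    (∀ γ ∈ X.Γ, ∃ r ∈ R, ∃ δ ∈ (ℓ.level N).1, γ = r * δ) ∧
    ∀ r ∈ R, ∃ r' ∈ X.Γ, r' * r = 1 ∧ ∀ i j, ‖X.τ₀ (r' i j)‖ ≤ Cr * (q₀ : ℝ) ^ (k * N)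

/-! ## 3. The assembly -/

/-- The volume of the ball is finite (it lies in the closed unit ball of `ℂ²`). -/
theorem volume_ball_ne_top : (volume (ball : Set (Fin 2 → ℂ))) ≠ ⊤ := by
  refine ne_top_of_le_ne_top (isCompact_closedBall (0 : Fin 2 → ℂ) 1).measure_lt_top.ne (measure_mono ?_)
  intro z hz
  rw [Metric.mem_closedBall, dist_zero_right, pi_norm_le_iff_of_nonneg zero_le_one]
  intro k
  have h := norm_lift3_le_one hz (Fin.castSucc k)
  fin_cases k <;> simpa [lift3] using h

/-- On a translate `actM M '' F` of a measurable set at distance `1 − r₀` from the boundary, with the entries of `M`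
bounded by `B > 0`, the off-main density is bounded by the (A)-bound at `ε = (1 − r₀)/(9 B²)`, so its integral is at
most that constant times the volume of the ball. -/
theorem lintegral_translate_le (D : X.ThetaData) {K : X.Level} (γ : X.Tr K) (xm : X.Tuple)
    {M : Matrix (Fin 3) (Fin 3) ℂ} (hM : Mᴴ * J * M = J) {B : ℝ} (hB0 : 0 < B) (hB : ∀ i j, ‖M i j‖ ≤ B)
    {F : Set (Fin 2 → ℂ)} (hFm : MeasurableSet F) (hFb : F ⊆ ball) {r₀ : ℝ} (hr₀ : r₀ < 1)
    (hFr : ∀ z ∈ F, nsq z ≤ r₀) {c : ℝ} (hc : 0 ≤ c) {m : ℕ}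
    (hA : ∀ z ∈ ball, X.offMainDensity D γ xm z ≤ ENNReal.ofReal (c / (1 - nsq z) ^ m)) :
    ∫⁻ z in actM M '' F, X.offMainDensity D γ xm z ≤
      ENNReal.ofReal (c / ((1 - r₀) / (9 * B ^ 2)) ^ m) * volume (ball : Set (Fin 2 → ℂ)) := by
  have hε : 0 < (1 - r₀) / (9 * B ^ 2) := by
    have : 0 < 1 - r₀ := sub_pos.mpr hr₀
    positivity
  have hpt : ∀ w ∈ actM M '' F,
      X.offMainDensity D γ xm w ≤ ENNReal.ofReal (c / ((1 - r₀) / (9 * B ^ 2)) ^ m) := by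
    rintro _ ⟨z, hz, rfl⟩
    have hzb : z ∈ ball := hFb hz
    have hwb : actM M z ∈ ball := actM_mem_ball hM hzb
    refine (hA _ hwb).trans (ENNReal.ofReal_le_ofReal ?_)
    have h1 : (1 - r₀) / (9 * B ^ 2) ≤ 1 - nsq (actM M z) :=
      le_trans (div_le_div_of_nonneg_right (by linarith [hFr z hz]) (by positivity))
        (one_sub_nsq_actM_ge hM hB hzb)
    have h2 : ((1 - r₀) / (9 * B ^ 2)) ^ m ≤ (1 - nsq (actM M z)) ^ m := pow_le_pow_left₀ hε.le h1 m
    exact div_le_div_of_nonneg_left hc (pow_pos hε m) h2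
  calc ∫⁻ z in actM M '' F, X.offMainDensity D γ xm z
      ≤ ∫⁻ _ in actM M '' F, ENNReal.ofReal (c / ((1 - r₀) / (9 * B ^ 2)) ^ m) :=
        lintegral_mono_ae ((ae_restrict_mem (measurableSet_image_actM hM hFm hFb)).mono hpt)
    _ = ENNReal.ofReal (c / ((1 - r₀) / (9 * B ^ 2)) ^ m) * volume (actM M '' F) := setLIntegral_const _ _
    _ ≤ ENNReal.ofReal (c / ((1 - r₀) / (9 * B ^ 2)) ^ m) * volume (ball : Set (Fin 2 → ℂ)) := by
        refine mul_le_mul_right (measure_mono ?_) _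
        rintro _ ⟨z, hz, rfl⟩
        exact actM_mem_ball hM (hFb hz)

/-- **THE RESIDUAL FROM THE THREE RUNGS**: (A) the pointwise bound, (B) bounded coset representatives, (C) the BHC
relatively compact fundamental domain of `Γ` and the fundamental-domain property of the chosen domains of the levels
give `OffMainMass`, hence (`TermDominatedAssembly`) L3.5 `term_dominated`. -/
theorem offMainMass_of_bounds (D : X.ThetaData) {p : IsDedekindDomain.HeightOneSpectrum (NumberField.RingOfIntegers X.E)}
    {L₀ : Submodule (NumberField.RingOfIntegers X.E) (Fin 3 → X.E)} {xm : X.Tuple} (ℓ : X.LocS D p L₀ xm)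
    {q₀ : ℕ} (hq₀ : 1 ≤ q₀) (hA : X.PointwiseOffMainBound D p L₀ xm ℓ) (hR : X.BoundedCosetReps D p L₀ xm ℓ q₀)
    {F : Set (Fin 2 → ℂ)} (hF : IsFundamentalDomainFor (ballActions X.τ₀ X.C X.Γ) F) {r₀ : ℝ} (hr₀ : r₀ < 1)
    (hFr : ∀ z ∈ F, nsq z ≤ r₀)
    (hdom : ∀ N, IsFundamentalDomainFor (ballActions X.τ₀ X.C (ℓ.level N).1) (X.domain (ℓ.level N))) :
    Nonempty (X.OffMainMass D p L₀ xm ℓ) := by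
  classical
  obtain ⟨K, κ, m, hκ, hK, hA⟩ := hA
  obtain ⟨Cr, k, hCr, hR⟩ := hR
  obtain ⟨b₁, hb₁, hC₁⟩ := exists_entry_bound X.C⁻¹
  obtain ⟨b₂, _hb₂, hC₂⟩ := exists_entry_bound X.C
  have hτ : ∀ x, X.τ₀ (X.c x) = conj (X.τ₀ x) := fun x => complexConj_intertwines X.E X.τ₀ x
  have hq₀R : (1 : ℝ) ≤ q₀ := by exact_mod_cast hq₀
  have h1r : 0 < 1 - r₀ := sub_pos.mpr hr₀
  -- the constants
  set c₀ : ℝ := 9 * b₁ * b₂ * Cr + 1 with hc₀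
  have hc₀pos : 0 < c₀ := by positivity
  set V : ℝ := (volume (ball : Set (Fin 2 → ℂ))).toReal with hV
  have hV0 : 0 ≤ V := ENNReal.toReal_nonneg
  have hVeq : volume (ball : Set (Fin 2 → ℂ)) = ENNReal.ofReal V := (ENNReal.ofReal_toReal volume_ball_ne_top).symm
  set c₂ : ℝ := (9 * c₀ ^ 2 / (1 - r₀)) ^ m with hc₂
  have hc₂0 : 0 ≤ c₂ := by positivity
  have hmass : ∀ N, ∫⁻ z in X.domain (ℓ.level N),
      ∑' w : {w : X.LineTuple // X.orbitOf w ≠ X.orbitOf (X.lines xm)}, ‖X.summand D.Φ D.cf (ℓ.loc N) w.1 z‖ₑ ≤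
      ENNReal.ofReal (K * c₂ * V * ((q₀ : ℝ) ^ (9 * Module.finrank ℚ X.E + 2 * k * m)) ^ N *
        X.offMainDecay p κ N) := by
    intro N
    obtain ⟨R, hRf, hRΓ, hRcard, hRcov, hRinv⟩ := hR N
    -- the inverses of the representatives
    let inv : Matrix (Fin 3) (Fin 3) X.E → Matrix (Fin 3) (Fin 3) X.E := fun r =>
      if h : r ∈ R then Classical.choose (hRinv r h) else 1
    have hinv : ∀ r ∈ R, inv r ∈ X.Γ ∧ inv r * r = 1 := fun r hr => by
      simp only [inv, dif_pos hr]
      exact ⟨(Classical.choose_spec (hRinv r hr)).1, (Classical.choose_spec (hRinv r hr)).2.1⟩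
    have hinv_entries : ∀ r ∈ R, ∀ i j, ‖X.τ₀ (inv r i j)‖ ≤ Cr * (q₀ : ℝ) ^ (k * N) := fun r hr i j => by
      simp only [inv, dif_pos hr]
      exact (Classical.choose_spec (hRinv r hr)).2.2 i j
    -- the entry bound of the transfers of the inverses
    set B : ℝ := c₀ * (q₀ : ℝ) ^ (k * N) with hB
    have hqkN : (1 : ℝ) ≤ (q₀ : ℝ) ^ (k * N) := one_le_pow₀ hq₀R
    have hBpos : 0 < B := by positivity
    have hMB : ∀ r ∈ R, ∀ i j, ‖toBallMat X.τ₀ X.C (inv r) i j‖ ≤ B := fun r hr i j => by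
      have h := X.norm_toBallMat_apply_le hb₁ hC₁ hC₂ (by positivity) (hinv_entries r hr) i j
      calc ‖toBallMat X.τ₀ X.C (inv r) i j‖ ≤ 9 * (b₁ * b₂ * (Cr * (q₀ : ℝ) ^ (k * N))) := h
        _ = 9 * b₁ * b₂ * Cr * (q₀ : ℝ) ^ (k * N) := by ring
        _ = c₀ * (q₀ : ℝ) ^ (k * N) - (q₀ : ℝ) ^ (k * N) := by rw [hc₀]; ring
        _ ≤ c₀ * (q₀ : ℝ) ^ (k * N) := by linarith [hqkN]
    -- the pointwise bound at depth `N`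
    have hAN : ∀ z ∈ ball, X.offMainDensity D (ℓ.loc N) xm z ≤
        ENNReal.ofReal ((K * X.offMainDecay p κ N) / (1 - nsq z) ^ m) := fun z hz => hA N z hz
    have hKd : 0 ≤ K * X.offMainDecay p κ N := mul_nonneg hK (X.offMainDecay_nonneg p κ N)
    -- the per-translate bound
    have htr : ∀ r : R, ∫⁻ z in actM (toBallMat X.τ₀ X.C (inv r.1)) '' F, X.offMainDensity D (ℓ.loc N) xm z ≤
        ENNReal.ofReal ((K * X.offMainDecay p κ N) / ((1 - r₀) / (9 * B ^ 2)) ^ m) *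
          volume (ball : Set (Fin 2 → ℂ)) := fun r =>
      X.lintegral_translate_le D (ℓ.loc N) xm (toBallMat_unitaryJ X.hΓ hτ X.hC (hinv r.1 r.2).1) hBpos
        (hMB r.1 r.2) hF.1 hF.2.1 hr₀ hFr hKd hAN
    haveI : Finite R := hRf.to_subtype
    -- the chain
    show ∫⁻ z in X.domain (ℓ.level N), X.offMainDensity D (ℓ.loc N) xm z ≤ _
    calc ∫⁻ z in X.domain (ℓ.level N), X.offMainDensity D (ℓ.loc N) xm z
        ≤ ∑' r : R, ∫⁻ z in actM (toBallMat X.τ₀ X.C (inv r.1)) '' F, X.offMainDensity D (ℓ.loc N) xm z :=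
          lintegral_domain_le_sum_translates X.hΓ (ℓ.level N).2.1 hτ X.hC (hdom N) hF hRf hRcov inv hinv
            (X.aemeasurable_offMainDensity D (ℓ.loc N) xm) (X.offMainDensity_isInvariant D (ℓ.level N) (ℓ.loc N) xm)
      _ ≤ ∑' _ : R, ENNReal.ofReal ((K * X.offMainDecay p κ N) / ((1 - r₀) / (9 * B ^ 2)) ^ m) *
            volume (ball : Set (Fin 2 → ℂ)) := ENNReal.tsum_le_tsum htr
      _ = (Nat.card R : ℝ≥0∞) * (ENNReal.ofReal ((K * X.offMainDecay p κ N) / ((1 - r₀) / (9 * B ^ 2)) ^ m) *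
            volume (ball : Set (Fin 2 → ℂ))) := by
          rw [ENNReal.tsum_const, ENat.card_eq_coe_natCard, ENat.toENNReal_coe]
      _ = ENNReal.ofReal ((Nat.card R : ℝ) *
            ((K * X.offMainDecay p κ N) / ((1 - r₀) / (9 * B ^ 2)) ^ m * V)) := by
          have hε : 0 < (1 - r₀) / (9 * B ^ 2) := by positivity
          rw [hVeq, ← ENNReal.ofReal_mul (div_nonneg hKd (pow_pos hε m).le), ← ENNReal.ofReal_natCast,
            ← ENNReal.ofReal_mul (Nat.cast_nonneg _)]
      _ ≤ ENNReal.ofReal (K * c₂ * V * ((q₀ : ℝ) ^ (9 * Module.finrank ℚ X.E + 2 * k * m)) ^ N *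
            X.offMainDecay p κ N) := by
          refine ENNReal.ofReal_le_ofReal ?_
          have hcard : (Nat.card R : ℝ) ≤ (q₀ : ℝ) ^ (9 * Module.finrank ℚ X.E * N) := by
            have h := hRcard
            have h' : ((Nat.card R : ℕ) : ℝ) ≤ (((q₀ ^ N) ^ Module.finrank ℚ X.E) ^ 9 : ℕ) := by exact_mod_cast h
            calc (Nat.card R : ℝ) ≤ (((q₀ ^ N) ^ Module.finrank ℚ X.E) ^ 9 : ℕ) := h'
              _ = (q₀ : ℝ) ^ (9 * Module.finrank ℚ X.E * N) := by
                  push_cast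
                  rw [← pow_mul, ← pow_mul]
                  ring_nf
          have hident : (K * X.offMainDecay p κ N) / ((1 - r₀) / (9 * B ^ 2)) ^ m =
              K * X.offMainDecay p κ N * (c₂ * (q₀ : ℝ) ^ (2 * k * m * N)) := by
            rw [div_eq_mul_one_div, one_div, ← inv_pow, inv_div, hB, hc₂]
            have h9 : 9 * (c₀ * (q₀ : ℝ) ^ (k * N)) ^ 2 / (1 - r₀) =
                9 * c₀ ^ 2 / (1 - r₀) * ((q₀ : ℝ) ^ (k * N)) ^ 2 := by ring
            rw [h9, mul_pow, ← pow_mul, ← pow_mul]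
            ring_nf
          rw [hident]
          have hpow : ((q₀ : ℝ) ^ (9 * Module.finrank ℚ X.E + 2 * k * m)) ^ N =
              (q₀ : ℝ) ^ (9 * Module.finrank ℚ X.E * N) * (q₀ : ℝ) ^ (2 * k * m * N) := by
            rw [← pow_mul, ← pow_add]
            ring_nf
          rw [hpow]
          have hdec : 0 ≤ X.offMainDecay p κ N := X.offMainDecay_nonneg p κ N
          have hq2 : 0 ≤ (q₀ : ℝ) ^ (2 * k * m * N) := by positivity
          calc (Nat.card R : ℝ) * (K * X.offMainDecay p κ N * (c₂ * (q₀ : ℝ) ^ (2 * k * m * N)) * V)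
              ≤ (q₀ : ℝ) ^ (9 * Module.finrank ℚ X.E * N) *
                  (K * X.offMainDecay p κ N * (c₂ * (q₀ : ℝ) ^ (2 * k * m * N)) * V) :=
                mul_le_mul_of_nonneg_right hcard (by positivity)
            _ = K * c₂ * V * ((q₀ : ℝ) ^ (9 * Module.finrank ℚ X.E * N) * (q₀ : ℝ) ^ (2 * k * m * N)) *
                  X.offMainDecay p κ N := by ring

  exact ⟨⟨κ, hκ, K * c₂ * V, (q₀ : ℝ) ^ (9 * Module.finrank ℚ X.E + 2 * k * m),
    mul_nonneg (mul_nonneg hK hc₂0) hV0, pow_nonneg (Nat.cast_nonneg q₀) _, hmass⟩⟩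


/-- The fundamental-domain property of the chosen domains from the printed BHC row (as L3.c). -/
theorem domain_isFundamental_of_lit' (K : X.Level)
    (h : Lit.BorelHarishChandra1962_Thm11_8_fundamentalDomain_hdef X.E X.H X.τ₀ X.C) :
    IsFundamentalDomainFor (ballActions X.τ₀ X.C K.1) (X.domain K) := by
  have hD : ∃ D : Set (Fin 2 → ℂ), IsFundamentalDomainFor (ballActions X.τ₀ X.C K.1) D ∧
      ∃ r : ℝ, r < 1 ∧ ∀ z ∈ D, nsq z ≤ r :=
    h X.hHerm X.hAn X.hC X.hDef K.1 K.2.1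
  unfold T4Data.domain
  rw [dif_pos hD]
  exact (Classical.choose_spec hD).1

/-- **THE RESIDUAL FROM (A), (B) AND THE PRINTED BHC ROW**: `OffMainMass` for every localiser. -/
theorem offMainMass_of_bounds_of_lit (D : X.ThetaData)
    {p : IsDedekindDomain.HeightOneSpectrum (NumberField.RingOfIntegers X.E)}
    {L₀ : Submodule (NumberField.RingOfIntegers X.E) (Fin 3 → X.E)} {xm : X.Tuple} (ℓ : X.LocS D p L₀ xm)
    {q₀ : ℕ} (hq₀ : 1 ≤ q₀) (hA : X.PointwiseOffMainBound D p L₀ xm ℓ) (hR : X.BoundedCosetReps D p L₀ xm ℓ q₀)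
    (hlit : Lit.BorelHarishChandra1962_Thm11_8_fundamentalDomain_hdef X.E X.H X.τ₀ X.C) :
    Nonempty (X.OffMainMass D p L₀ xm ℓ) := by
  obtain ⟨F, hF, r₀, hr₀, hFr⟩ := hlit X.hHerm X.hAn X.hC X.hDef X.Γ X.hΓ
  exact X.offMainMass_of_bounds D ℓ hq₀ hA hR hF hr₀ hFr (fun N => X.domain_isFundamental_of_lit' (ℓ.level N) hlit)

/-- **L3.5 FROM (A), (B) AND THE PRINTED BHC ROW** — the conclusion of `term_dominated`, verbatim. -/
theorem term_dominated_of_bounds (D : X.ThetaData)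
    {p : IsDedekindDomain.HeightOneSpectrum (NumberField.RingOfIntegers X.E)}
    {L₀ : Submodule (NumberField.RingOfIntegers X.E) (Fin 3 → X.E)} {xm : X.Tuple} (ℓ : X.LocS D p L₀ xm)
    {q₀ : ℕ} (hq₀ : 1 ≤ q₀) (hA : X.PointwiseOffMainBound D p L₀ xm ℓ) (hR : X.BoundedCosetReps D p L₀ xm ℓ q₀)
    (hlit : Lit.BorelHarishChandra1962_Thm11_8_fundamentalDomain_hdef X.E X.H X.τ₀ X.C) :
    ∃ bound : X.Orbit → ℝ, (∀ o, 0 ≤ bound o) ∧ Summable bound ∧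
      ∀ N (o : X.Orbit), o ≠ X.orbitOf (X.lines xm) → ‖X.term D.Φ D.cf (ℓ.level N) (ℓ.loc N) o‖ ≤ bound o :=
  X.term_dominated_of_offMainMass D ℓ (X.offMainMass_of_bounds_of_lit D ℓ hq₀ hA hR hlit).some

end T4Data

end Summit.Ventures.HodgeRepro.Tier4.Line3

end
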